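import Summits.ResolutionOfSingularities.ResolutionOfSingularities.Theorems.PlanarCutWalks
import HarnessLib

/-!
# MaxContactCutPlanarCut — decomp-res node «PlanarCut» (lens-5 g18 rev 1), tree file 5/5: §6 THE CLASSES and
the host BY NAME.
THE WINDOW `NoPlanarRepeatTranslationTails` [DECIDED: THEOREM `noPlanarRepeatTranslationTails_holds`] and its
COMPONENT form (§6b, rev 1:
the wall need only DIVIDE `F_N`) `NoComponentPlanarRepeatTranslationTails` [THEOREM]; THE LOCATED RESIDUAL
`NoNonComponentPlanarRepeatTranslationRecurrentExcessPlateauxDeep` ≡ `NoNonPlanarRepeatTranslationRecurrentExcessPlateauxDeep`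
(`nonComponentPlanar_iff_nonPlanar`) ≡ the tree's joint residual
`ExitLaw.NoRepeatTranslationRecurrentExcessPlateauxDeep` (EXACT
`joint_iff_nonPlanar`, `joint_iff_nonComponentPlanar`, hypothesis-free); 31770 BY NAME: `closes (hA : NoFreePointTailsDeep)
(hNP : NoNonPlanarRepeatTranslationRecurrentExcessPlateauxDeep) : MaxContactCut.DefectWalksDeep`, `closes_component`, EXACT
`defectWalksDeep_iff_nonPlanar`.  (Critic row 119a: ONE located residual, filed in the component form; the window
classes are theorems.)

Content VERBATIM from the decomp-res lens-5 g18 file `HOME/decomp-res-lens-5/g18/parts/PlanarCut-REV1-155d4ffb.lean`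
(sha256 155d4ffbaf2b8fc3; the REV1
pin the critic graded, CRITIC-LEDGER rows 119 + 119a CLEARED: DECIDED +1 · MAP +1; supersedes the NODE pin b3c721b9).  HOME =
run/shared/lean/pub/decomp-res.  Host: route `MaxContactCut`, aside 31770 `MaxContactCut.DefectWalksDeep` BY NAME
through the tree's
`ExitLaw.defectWalksDeep_iff_joint'` (`Theorems/MaxContactCutExitLaw`).

[WRITER NOTE (decomp-res writer g6): the lens file is split into `PlanarCutStates` (§1–§4 state level) →
`PlanarCutRows` (the Taylor row of a
layer) → `PlanarCutMoves` (strict-multiplicity inequalities, dead layers) → `PlanarCutWalks` (§5 walk level: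
potential, descent, kill) →
`MaxContactCutPlanarCut` (§6/§6b classes + `closes` BY NAME); `set_option` lines dropped; §7 adapters (VERBATIM
restatements of lens-5 g17
`TransportCut` / lens-3 g15 `ConeCut` classes) are NOT landed here — they follow once `Theorems/TransportCut*` /
`ConeCut*` are in the tree
(critic row 119: import, do not duplicate).  All files sit inside the Theses cone (the exit-law walk model
`ExitLawStates` imports the
route's itinerary model), so the §6 classes are booked as TREE THEOREMS / docstrings, not as route asides.]
(Sources: Hauser2010 §§D–G; HauserPerlega2019; CossartJannsenSaito2020 Thm. 2.14; CossartPiltant2019; Moh1987.)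
-/

noncomputable section

open MvPolynomial Finset
open Literature.AlgebraicGeometry.Resolution
open Literature.AlgebraicGeometry.Resolution.Hauser2010
open Literature.AlgebraicGeometry.Resolution.PointBlowup
open Literature.AlgebraicGeometry.Resolution.WeightedBlowup
open Summit.ResolutionOfSingularities.ResolutionOfSingularities.Theses
open Summit.ResolutionOfSingularities.ResolutionOfSingularities.Theorems.TightDefectClasses
open Summit.ResolutionOfSingularities.ResolutionOfSingularities.Theorems.TightDefectStrongWalks
open Summit.ResolutionOfSingularities.ResolutionOfSingularities.Theorems.ItineraryCutClasses
open Summit.ResolutionOfSingularities.ResolutionOfSingularities.Theorems.BoundaryLedger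
open Summit.ResolutionOfSingularities.ResolutionOfSingularities.Theorems.ProximityCut
open Summit.ResolutionOfSingularities.ResolutionOfSingularities.Theorems.ExitLaw

namespace Summit.ResolutionOfSingularities.ResolutionOfSingularities.Theorems.PlanarCut

/-! ## §6 The classes: the window (PROVED EMPTY) and the located residual (EXACT split of the joint residual) -/

section Classes

/-- WINDOW · **THE PLANAR PROXIMITY LAW** as a class (all `e ≥ 1`, no shade / plateau / excess hypotheses) ·
PROVED (`noPlanarRepeatTranslationTails_holds`): no forced walk from a root is, from some step on, BOUNDARY-PLANAR
along a wall `u_k = 0` of positive multiplicity with infinitely many proximity repeats and infinitely many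
translated moves. -/
def NoPlanarRepeatTranslationTails : Prop :=
  ∀ p : ℕ, p.Prime → ∀ e : ℕ, 1 ≤ e → ∀ (K : Type) [Field K] [CharP K p] [PerfectField K] [DecidableEq K]
    (s₀ : State (Fin 3) K), IsRoot (p ^ e) s₀ → ∀ W : ForcedWalk (p ^ e) s₀,
    ∀ (k : Fin 3) (N : ℕ), (∀ t, N ≤ t → W.j t ≠ k ∧ W.b t k = 0) → 1 ≤ (W.st N).r k →
    (∀ M : ℕ, ∃ t, M ≤ t ∧ StaysOnNewest W t) → (∀ M : ℕ, ∃ t, M ≤ t ∧ W.b t ≠ 0) → False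

/-- **THE WINDOW IS EMPTY (PROVED).** [new] [folklore] -/
theorem noPlanarRepeatTranslationTails_holds : NoPlanarRepeatTranslationTails :=
  fun _ _ _ _ _ _ _ _ _ _ hs W k N hP hr hS hb => noPlanarTails hs W k N hP hr hS hb

/-- The window on the deep defect column with the joint residual's binders, BY INSTANTIATION. [new] [folklore] -/
theorem noPlanarRepeatTranslationTails_deep :
    ∀ p : ℕ, p.Prime → ∀ e : ℕ, 2 ≤ e → ∀ (K : Type) [Field K] [CharP K p] [PerfectField K] [DecidableEq K]
    (s₀ : State (Fin 3) K), IsRoot (p ^ e) s₀ → ∀ W : ForcedWalk (p ^ e) s₀, (∀ i, 1 ≤ (W.st i).shade) →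
    ∀ N : ℕ, (∀ t, N ≤ t → (W.st (t + 1)).shade = (W.st t).shade) →
    (∀ t, N ≤ t → ordZero (W.st t).F ≠ ((p ^ e : ℕ) : ℕ∞)) →
    (∀ M : ℕ, ∃ t, M ≤ t ∧ StaysOnNewest W t) → (∀ M : ℕ, ∃ t, M ≤ t ∧ W.b t ≠ 0) →
    ∀ (k : Fin 3) (N' : ℕ), (∀ t, N' ≤ t → W.j t ≠ k ∧ W.b t k = 0) → 1 ≤ (W.st N').r k → False :=
  fun _ _ _ _ _ _ _ _ _ _ hs W _ _ _ _ hS hb k N' hP hr => noPlanarTails hs W k N' hP hr hS hb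

/-- RESIDUAL · THE LOCATED COMPLEMENT of the window inside the joint residual
`ExitLaw.NoRepeatTranslationRecurrentExcessPlateauxDeep` (binders VERBATIM, plus NON-PLANARITY): no infinite deep
defect walk on an eventual excess plateau with infinitely many proximity repeats and infinitely many translated
moves EVERY boundary-planar tail of which is a GHOST tail (`r_k = 0` on it; by `r_wall_eq` the wall multiplicity is
constant along a planar tail).  UNDECIDED · `≡` the joint residual (`joint_iff_nonPlanar`, EXACT, hypothesis-free). -/
def NoNonPlanarRepeatTranslationRecurrentExcessPlateauxDeep : Prop :=
  ∀ p : ℕ, p.Prime → ∀ e : ℕ, 2 ≤ e → ∀ (K : Type) [Field K] [CharP K p] [PerfectField K] [DecidableEq K]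
    (s₀ : State (Fin 3) K), IsRoot (p ^ e) s₀ → ∀ W : ForcedWalk (p ^ e) s₀, (∀ i, 1 ≤ (W.st i).shade) →
    ∀ N : ℕ, (∀ t, N ≤ t → (W.st (t + 1)).shade = (W.st t).shade) →
    (∀ t, N ≤ t → ordZero (W.st t).F ≠ ((p ^ e : ℕ) : ℕ∞)) →
    (∀ M : ℕ, ∃ t, M ≤ t ∧ StaysOnNewest W t) → (∀ M : ℕ, ∃ t, M ≤ t ∧ W.b t ≠ 0) →
    (∀ (k : Fin 3) (N' : ℕ), (∀ t, N' ≤ t → W.j t ≠ k ∧ W.b t k = 0) → (W.st N').r k = 0) → False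

/-- **EXACT SPLIT (PROVED, hypothesis-free):** the joint residual `⟺` its non-planar part — the planar part is the
proved law. [new] [folklore] -/
theorem joint_iff_nonPlanar :
    NoRepeatTranslationRecurrentExcessPlateauxDeep ↔ NoNonPlanarRepeatTranslationRecurrentExcessPlateauxDeep := by
  constructor
  · intro h p hp e he K _ _ _ _ s₀ hs W hsh N hpl hex hS hb _
    exact h p hp e he K s₀ hs W hsh N hpl hex hS hb
  · intro h p hp e he K _ _ _ _ s₀ hs W hsh N hpl hex hS hb
    by_cases hpl' : ∃ (k : Fin 3) (N' : ℕ), (∀ t, N' ≤ t → W.j t ≠ k ∧ W.b t k = 0) ∧ 1 ≤ (W.st N').r k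
    · obtain ⟨k, N', hP, hr⟩ := hpl'
      exact noPlanarTails hs W k N' hP hr hS hb
    · push Not at hpl'
      exact h p hp e he K s₀ hs W hsh N hpl hex hS hb fun k N' hP => by have := hpl' k N' hP; omega

/-- **`closes`: THE HOST TARGET FROM THE LOCATED RESIDUAL (PROVED).**  Deep arc law (DECIDED in the tree's desk sense,
hypothesis here as in `ExitLaw.closes₂'`) ∧ non-planar joint residual ⇒ `MaxContactCut.DefectWalksDeep` (= 31770
by name). [new] [folklore] -/
theorem closes (hA : NoFreePointTailsDeep) (hNP : NoNonPlanarRepeatTranslationRecurrentExcessPlateauxDeep) :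
    MaxContactCut.DefectWalksDeep :=
  defectWalksDeep_iff_joint'.mpr ⟨hA, joint_iff_nonPlanar.mpr hNP⟩

/-- THE EXACT CUT of the host target down to the new residual. [new] [folklore] -/
theorem defectWalksDeep_iff_nonPlanar :
    MaxContactCut.DefectWalksDeep ↔ NoFreePointTailsDeep ∧ NoNonPlanarRepeatTranslationRecurrentExcessPlateauxDeep := by
  rw [defectWalksDeep_iff_joint', joint_iff_nonPlanar]

/-- NECESSITY: the new residual is implied by the host target. [folklore] -/
theorem nonPlanar_of_defectWalksDeep (h : MaxContactCut.DefectWalksDeep) :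
    NoNonPlanarRepeatTranslationRecurrentExcessPlateauxDeep :=
  (defectWalksDeep_iff_nonPlanar.mp h).2

/-! ### §6b Component form (rev 1): the wall need only DIVIDE `F_N` — ghost walls that are components are cut too -/

/-- WINDOW, COMPONENT FORM (STRONGER CLASS) · PROVED (`noComponentPlanarRepeatTranslationTails_holds`): the same
statement with `r_k ≥ 1` replaced by `u_k ∣ F_N` (every exponent of `F_N` has `d_k ≥ 1`; `r_k ≥ 1` is the special
case `walk_r`).  It also kills the ghost-planar tails (`r_k = 0`) along which the wall happens to divide `F`. -/
def NoComponentPlanarRepeatTranslationTails : Prop :=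
  ∀ p : ℕ, p.Prime → ∀ e : ℕ, 1 ≤ e → ∀ (K : Type) [Field K] [CharP K p] [PerfectField K] [DecidableEq K]
    (s₀ : State (Fin 3) K), IsRoot (p ^ e) s₀ → ∀ W : ForcedWalk (p ^ e) s₀,
    ∀ (k : Fin 3) (N : ℕ), (∀ t, N ≤ t → W.j t ≠ k ∧ W.b t k = 0) → (∀ d ∈ (W.st N).F.support, 1 ≤ d k) →
    (∀ M : ℕ, ∃ t, M ≤ t ∧ StaysOnNewest W t) → (∀ M : ℕ, ∃ t, M ≤ t ∧ W.b t ≠ 0) → False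

/-- **THE COMPONENT-FORM WINDOW IS EMPTY (PROVED).** [new] [folklore] -/
theorem noComponentPlanarRepeatTranslationTails_holds : NoComponentPlanarRepeatTranslationTails :=
  fun _ _ _ _ _ _ _ _ _ _ hs W k N hP hd hS hb =>
    noPlanarTails_of_layer_zero hs W k N hP ((layer_zero_eq_empty_iff k _).mpr hd) hS hb

/-- The component form implies the multiplicity form (by `walk_r`). [folklore] -/
theorem noPlanar_of_noComponentPlanar (h : NoComponentPlanarRepeatTranslationTails) :
    NoPlanarRepeatTranslationTails :=
  fun p hp e he K _ _ _ _ s₀ hs W k N hP hr hS hb =>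
    h p hp e he K s₀ hs W k N hP (fun d hd => le_trans hr (Finsupp.le_def.mp (walk_r hs W N d hd) k)) hS hb

/-- RESIDUAL, COMPONENT FORM (SHARPER LOCATION) · joint binders VERBATIM + «no wall respected from `N'` on divides
`F_{N'}`» (for every planar tail some exponent of `F_{N'}` has `d_k = 0`; then layer `0` is non-empty at EVERY later
time, since emptiness propagates forward, `layer_zero_empty_of_planar`).  UNDECIDED · `≡` the joint residual
(`joint_iff_nonComponentPlanar`) · implies the multiplicity form termwise. -/
def NoNonComponentPlanarRepeatTranslationRecurrentExcessPlateauxDeep : Prop :=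
  ∀ p : ℕ, p.Prime → ∀ e : ℕ, 2 ≤ e → ∀ (K : Type) [Field K] [CharP K p] [PerfectField K] [DecidableEq K]
    (s₀ : State (Fin 3) K), IsRoot (p ^ e) s₀ → ∀ W : ForcedWalk (p ^ e) s₀, (∀ i, 1 ≤ (W.st i).shade) →
    ∀ N : ℕ, (∀ t, N ≤ t → (W.st (t + 1)).shade = (W.st t).shade) →
    (∀ t, N ≤ t → ordZero (W.st t).F ≠ ((p ^ e : ℕ) : ℕ∞)) →
    (∀ M : ℕ, ∃ t, M ≤ t ∧ StaysOnNewest W t) → (∀ M : ℕ, ∃ t, M ≤ t ∧ W.b t ≠ 0) →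
    (∀ (k : Fin 3) (N' : ℕ), (∀ t, N' ≤ t → W.j t ≠ k ∧ W.b t k = 0) → ∃ d ∈ (W.st N').F.support, d k = 0) →
    False

/-- **EXACT SPLIT, COMPONENT FORM (PROVED, hypothesis-free).** [new] [folklore] -/
theorem joint_iff_nonComponentPlanar : NoRepeatTranslationRecurrentExcessPlateauxDeep ↔
    NoNonComponentPlanarRepeatTranslationRecurrentExcessPlateauxDeep := by
  constructor
  · intro h p hp e he K _ _ _ _ s₀ hs W hsh N hpl hex hS hb _
    exact h p hp e he K s₀ hs W hsh N hpl hex hS hb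
  · intro h p hp e he K _ _ _ _ s₀ hs W hsh N hpl hex hS hb
    by_cases hpl' : ∃ (k : Fin 3) (N' : ℕ), (∀ t, N' ≤ t → W.j t ≠ k ∧ W.b t k = 0) ∧
        ∀ d ∈ (W.st N').F.support, 1 ≤ d k
    · obtain ⟨k, N', hP, hd⟩ := hpl'
      exact noPlanarTails_of_layer_zero hs W k N' hP ((layer_zero_eq_empty_iff k _).mpr hd) hS hb
    · push Not at hpl'
      exact h p hp e he K s₀ hs W hsh N hpl hex hS hb fun k N' hP => by
        obtain ⟨d, hd, hlt⟩ := hpl' k N' hP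
        exact ⟨d, hd, by omega⟩

/-- The two located residuals are the same class (both `≡` the joint residual). [folklore] -/
theorem nonComponentPlanar_iff_nonPlanar : NoNonComponentPlanarRepeatTranslationRecurrentExcessPlateauxDeep ↔
    NoNonPlanarRepeatTranslationRecurrentExcessPlateauxDeep := by
  rw [← joint_iff_nonComponentPlanar, joint_iff_nonPlanar]

/-- `closes` from the component-form residual. [new] [folklore] -/
theorem closes_component (hA : NoFreePointTailsDeep)
    (hNC : NoNonComponentPlanarRepeatTranslationRecurrentExcessPlateauxDeep) : MaxContactCut.DefectWalksDeep :=
  defectWalksDeep_iff_joint'.mpr ⟨hA, joint_iff_nonComponentPlanar.mpr hNC⟩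

end Classes

end Summit.ResolutionOfSingularities.ResolutionOfSingularities.Theorems.PlanarCut
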